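import Summits.Ventures.QEC.Decoders.PuncturedQuantumReedMullerFamily
import Literature.InformationTheory.QuantumCodes.QuantumReedMullerDecoderShortened
import HarnessLib

/-!
# Explicit Reed decoders for the punctured quantum Reed–Muller family `PQRM(m; a, b)` (every `a + b < m`): the optimal radius
# `2^{min(a,b)} − 1` is ATTAINED by majority logic

LADDER-QEC (venture cell `qec`), PARTITION row 08 (qec-type-08 gen 6, «08.PQRM-DEC», addendum to `PuncturedQuantumReedMullerFamily.lean`
p562409). Item 141 F6 (`QuantumReedMullerDecoderShortened.lean`) built the EXPLICIT shortened-Reed decoders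
`QRM.reedDecodeShortX m b` / `QRM.reedDecodeShortZ m a` (lift the syndrome to any consistent word, then Reed's two-trial majority-logic
residual for `ℛ(m−b−1,m)` / `ℛ(m−a−1,m)`) and proved their radii on the `k = 1` edge `a + b + 1 = m` (`QRM.shortCode`). The core
lemma `QRM.reedErrorShort_eq` is stated for every degree `s < m`, so the same decoders serve the whole family `PQRM(m;a,b)`,
`a + b < m` (`Summit.Ventures.QEC.PQRM.pqrm`): this file records it.

* ★ `pqrm_reedDecodeX_correctsUpTo (h : a + b < m)` — every bit-flip pattern of weight `≤ 2^b − 1` is corrected EXACTLY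
  (`d_X = 2^{b+1} − 1`); ★ `pqrm_reedDecodeZ_correctsUpTo` — every phase-flip pattern of weight `≤ 2^a − 1` (`d_Z = 2^{a+1} − 1`);
* `pqrm_reed_radius_optimal` — both sectors up to `2^{min(a,b)} − 1`, and no pair of sector decoders does better;
* members: `pqrm_hamming_reed` (the quantum Hamming family, radius `1`, every `m ≥ 3`), `pqrm_63_21_7_reed` (radius `3`),
  `pqrm_255_71_15_reed` (radius `7`).

TIER: KERNEL-std; 0 named facts, 0 sorry, no `decide`; axioms ⊆ {propext, Classical.choice, Quot.sound}. HONEST FRAMING: Reed's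
1954 majority-logic algorithm (MacWilliams–Sloane Ch. 13 §6) transported to the punctured family; code-capacity, sector-wise
statements; nothing probabilistic; no novelty word.

References: [MacWilliamsSloane1977] Ch. 13 §6 (chunk p0316: Reed decoding), §3 Thms 3–4; [NielsenChuang2010] §10.4.2 (p. 450: CSS
sector decoding); [Gottesman1997] §2.3 (radius ⌊(d−1)/2⌋).
-/

namespace Summit.Ventures.QEC.PQRM

open Matrix Finset Literature.InformationTheory.QuantumCodes Literature.InformationTheory.QuantumCodes.QRM
open Literature.InformationTheory.Coding Summit.Ventures.QEC.HGP

variable {m : ℕ}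

/-- The weight condition of `reedErrorShort_eq` from `‖e‖ ≤ 2^c − 1`, `c + s + 1 = m`. [folklore] -/
private theorem reed_weight_bound {c s : ℕ} (h : c + s + 1 = m) {w : ℕ} (hw : w ≤ 2 ^ c - 1) :
    2 * ((w + 1) * 2 ^ s) ≤ 2 ^ m := by
  have hp : 0 < 2 ^ c := Nat.two_pow_pos c
  have h2 : 2 ^ m = 2 ^ s * (2 * 2 ^ c) := by rw [← pow_succ', ← pow_add]; congr 1; omega
  rw [h2]
  have : w + 1 ≤ 2 ^ c := by omega
  nlinarith [Nat.two_pow_pos s]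

/-- ★ **The shortened Reed bit-flip decoder corrects every `X`-pattern of weight `≤ 2^b − 1` on `PQRM(m;a,b)`**, `a + b < m`
(Reed decoding of `ℛ(m−b−1,m)` on the lifted `Z`-syndrome; the correction equals the error exactly).
[cite: MacWilliamsSloane1977, Ch. 13 §6 (chunk p0316)] [cite: NielsenChuang2010, §10.4.2 (p. 450)] -/
theorem pqrm_reedDecodeX_correctsUpTo {a b : ℕ} (h : a + b < m) :
    (reedDecodeShortX m b).CorrectsUpTo (pqrm m a b h).xSyndrome
      ((pqrm m a b h).rowSpX : Set (Pt m → ZMod 2)) hammingNorm (2 ^ b - 1) := by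
  intro e he
  show reedDecodeShortX m b ((pqrm m a b h).xSyndrome e) + e ∈ ((pqrm m a b h).rowSpX : Set (Pt m → ZMod 2))
  rw [CSSCode.xSyndrome_apply, pqrm_HZ]
  unfold reedDecodeShortX
  obtain ⟨g, hg, hyg⟩ := liftSyndromeS_eq_restrict_add (r := b) (s := m - b - 1) (by omega) e
  rw [hyg, reedErrorShort_eq (by omega) hg (reed_weight_bound (c := b) (s := m - b - 1) (by omega) he)]
  have : e + e = 0 := by funext q; exact CharTwo.add_self_eq_zero _
  rw [this]
  exact (pqrm m a b h).rowSpX.zero_mem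

/-- ★ **The shortened Reed phase-flip decoder corrects every `Z`-pattern of weight `≤ 2^a − 1` on `PQRM(m;a,b)`**, `a + b < m`.
[cite: MacWilliamsSloane1977, Ch. 13 §6 (chunk p0316)] [cite: NielsenChuang2010, §10.4.2 (p. 450)] -/
theorem pqrm_reedDecodeZ_correctsUpTo {a b : ℕ} (h : a + b < m) :
    (reedDecodeShortZ m a).CorrectsUpTo (pqrm m a b h).zSyndrome
      ((pqrm m a b h).rowSpZ : Set (Pt m → ZMod 2)) hammingNorm (2 ^ a - 1) := by
  intro e he
  show reedDecodeShortZ m a ((pqrm m a b h).zSyndrome e) + e ∈ ((pqrm m a b h).rowSpZ : Set (Pt m → ZMod 2))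
  rw [CSSCode.zSyndrome, pqrm_HX]
  unfold reedDecodeShortZ
  obtain ⟨g, hg, hyg⟩ := liftSyndromeS_eq_restrict_add (r := a) (s := m - a - 1) (by omega) e
  rw [hyg, reedErrorShort_eq (by omega) hg (reed_weight_bound (c := a) (s := m - a - 1) (by omega) he)]
  have : e + e = 0 := by funext q; exact CharTwo.add_self_eq_zero _
  rw [this]
  exact (pqrm m a b h).rowSpZ.zero_mem

/-- `⌊(2^{c+1} − 1 − 1)/2⌋ = 2^c − 1`. [folklore] -/
private theorem two_pow_succ_sub_two_div_two'' (c : ℕ) : (2 ^ (c + 1) - 1 - 1) / 2 = 2 ^ c - 1 := by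
  have := Nat.one_le_two_pow (n := c)
  rw [pow_succ]; omega

/-- ★ **The explicit Reed decoders ATTAIN the optimal radius `2^{min(a,b)} − 1` of `PQRM(m;a,b)`** (`a + b < m`), and no pair of
sector decoders does better. [cite: Gottesman1997, §2.3 (chunk p0014 L3)] [cite: MacWilliamsSloane1977, Ch. 13 §6 (chunk p0316)] -/
theorem pqrm_reed_radius_optimal {a b : ℕ} (h : a + b < m) :
    ((reedDecodeShortX m b).CorrectsUpTo (pqrm m a b h).xSyndrome
        ((pqrm m a b h).rowSpX : Set (Pt m → ZMod 2)) hammingNorm (2 ^ min a b - 1) ∧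
      (reedDecodeShortZ m a).CorrectsUpTo (pqrm m a b h).zSyndrome
        ((pqrm m a b h).rowSpZ : Set (Pt m → ZMod 2)) hammingNorm (2 ^ min a b - 1)) ∧
    ∀ (DX : Decoder (MonoPos m b → ZMod 2) (Pt m → ZMod 2)) (DZ : Decoder (MonoPos m a → ZMod 2) (Pt m → ZMod 2)) (t : ℕ),
      DX.CorrectsUpTo (pqrm m a b h).xSyndrome ((pqrm m a b h).rowSpX : Set (Pt m → ZMod 2)) hammingNorm t →
        DZ.CorrectsUpTo (pqrm m a b h).zSyndrome ((pqrm m a b h).rowSpZ : Set (Pt m → ZMod 2)) hammingNorm t →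
          t ≤ 2 ^ min a b - 1 := by
  refine ⟨⟨(pqrm_reedDecodeX_correctsUpTo h).mono ?_, (pqrm_reedDecodeZ_correctsUpTo h).mono ?_⟩, fun DX DZ t hX hZ => ?_⟩
  · exact Nat.sub_le_sub_right (Nat.pow_le_pow_right (by norm_num) (min_le_right a b)) 1
  · exact Nat.sub_le_sub_right (Nat.pow_le_pow_right (by norm_num) (min_le_left a b)) 1
  · have := (pqrm_isCode h).le_half_of_correctsUpTo_sectors hX hZ
    rwa [two_pow_succ_sub_two_div_two''] at this

/-! ## Members -/

/-- **The quantum Hamming family `PQRM(m;1,1) = [[2^m − 1, 2^m − 1 − 2m, 3]]`**: the Reed decoders correct every single bit flip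
and every single phase flip (radius `1 = 2^1 − 1`), every `m ≥ 3`. [cite: MacWilliamsSloane1977, Ch. 13 §6 (chunk p0316)] -/
theorem pqrm_hamming_reed (hm : 3 ≤ m) :
    (reedDecodeShortX m 1).CorrectsUpTo (pqrm m 1 1 (by omega)).xSyndrome
        ((pqrm m 1 1 (by omega)).rowSpX : Set (Pt m → ZMod 2)) hammingNorm 1 ∧
      (reedDecodeShortZ m 1).CorrectsUpTo (pqrm m 1 1 (by omega)).zSyndrome
        ((pqrm m 1 1 (by omega)).rowSpZ : Set (Pt m → ZMod 2)) hammingNorm 1 :=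
  (pqrm_reed_radius_optimal (a := 1) (b := 1) (by omega)).1

/-- `PQRM(6;2,2) = [[63, 21, 7]]`: the Reed decoders correct every pattern of `≤ 3` bit flips and `≤ 3` phase flips.
[cite: MacWilliamsSloane1977, Ch. 13 §6 (chunk p0316)] -/
theorem pqrm_63_21_7_reed :
    (reedDecodeShortX 6 2).CorrectsUpTo (pqrm 6 2 2 (by norm_num)).xSyndrome
        ((pqrm 6 2 2 (by norm_num)).rowSpX : Set (Pt 6 → ZMod 2)) hammingNorm 3 ∧
      (reedDecodeShortZ 6 2).CorrectsUpTo (pqrm 6 2 2 (by norm_num)).zSyndrome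
        ((pqrm 6 2 2 (by norm_num)).rowSpZ : Set (Pt 6 → ZMod 2)) hammingNorm 3 :=
  (pqrm_reed_radius_optimal (m := 6) (a := 2) (b := 2) (by norm_num)).1

/-- `PQRM(8;3,3) = [[255, 71, 15]]`: the Reed decoders correct every pattern of `≤ 7` bit flips and `≤ 7` phase flips.
[cite: MacWilliamsSloane1977, Ch. 13 §6 (chunk p0316)] -/
theorem pqrm_255_71_15_reed :
    (reedDecodeShortX 8 3).CorrectsUpTo (pqrm 8 3 3 (by norm_num)).xSyndrome
        ((pqrm 8 3 3 (by norm_num)).rowSpX : Set (Pt 8 → ZMod 2)) hammingNorm 7 ∧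
      (reedDecodeShortZ 8 3).CorrectsUpTo (pqrm 8 3 3 (by norm_num)).zSyndrome
        ((pqrm 8 3 3 (by norm_num)).rowSpZ : Set (Pt 8 → ZMod 2)) hammingNorm 7 :=
  (pqrm_reed_radius_optimal (m := 8) (a := 3) (b := 3) (by norm_num)).1

end Summit.Ventures.QEC.PQRM
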